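import Summits.BirchSwinnertonDyer.Rank1Residual.X11b.Three.KolyvaginShaThreeOfProp37
import Summits.BirchSwinnertonDyer.Rank1Residual.X11b.KolyvaginHGZOfGross1991
import HarnessLib

/-!
# `Ш(E/K)[3^∞]` on the class X11b @ 3 with `ρ̄_{E,3}` onto — NO Kodaira–Néron sub-class (KN₃) —
# modulo TWO NAMED published facts (Gross 1991 Prop. 3.7 (2) and §6 / [GZ86, III (3.1)] BY NAME)

Cell `b2b-bsdres`, team x11b3 (N8/O2 = X11b @ 3); seat x11b3-p2 GEN 54 (unit claimed D-0075 →
BSD:K2/P4 «Kolyvagin-in-kernel»).  Summit-side THEOREM-ONLY file (no definition, no named fact,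
no `sorry`); `K : Type`; the literal prime `3`.

HONEST FRAMING (cell `b2b-bsdres`, run/shared/lean/b2b/bsd-rank1-residual/, verbatim in every
file): the goal of the cell is to DELETE the COMBINATION-SHAPED residual classes of the
Birch–Swinnerton-Dyer formula for ALL analytic-rank `≤ 1` elliptic curves over `ℚ` — "full BSD
formula for every rank `≤ 1` curve in class `C`" assembled STRICTLY from published theorems — so
that the rank-`≤ 1` remainder becomes exactly the CONSTRUCTION-SHAPED classes, which are TYPED
(missing-input `Prop`s), NOT attempted.  This is not "finishing BSD".  Nothing here is booked; no
mark / label / count / tier moves; X11b @ 3 = O2/B10 stays OPEN / CONSTRUCTION-SHAPED (Kolyvagin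
bounds `Ш` relative to the Heegner index; clause (iii) of `BSDp W 3` is NOT touched).

WHAT THIS FILE DOES.  The `p = 3` K-side class ENDs of record (`X11b/Three/KolyvaginShaThreeOfProp37`,
x11b3-p2 GEN 53) live on ClassX11b W 3 ∩ (KN₃)/ℚ — `hKN3m`: `3 ∤ ord_ℓ(Δ_min)` at every
multiplicative prime `ℓ`, `hKN3a`: no additive place of Kodaira type IV / IV* — where (KN₃) did TWO
jobs: (a) it SUPPLIED the receptacle binder `hGZ` ([GZ86, III (3.1)]: the Heegner points land in
`E⁰(K̄_v)` at the bad places after a multiple prime to `3`) by Kodaira–Néron, and (b) it made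
`ρ̄_{E,3}` onto (`Three.surj_three_of_classX11b_of_kodairaNeron_rat`: an inertial element of order
`3` at the multiplicative prime `3` plus irreducibility).  THIS FILE removes (KN₃): (a) is now the
NAMED Literature fact `Gross1991_heegnerPoint_sub_ratTorsion_mem_E0` read into the x11b3 binder by
`KolyvaginHloc.hGZ_of_gross1991E0` (`X11b/KolyvaginHGZOfGross1991`, this GEN), and (b) becomes the
class atom `Surj W 3` (`ρ̄_{E,3}` onto, RESIDUAL-CASES vocabulary `Rank1Residual.Surj`) as an
HYPOTHESIS — so the ENDs now cover ClassX11b W 3 ∩ surj(3), i.e. ALL of X11b @ 3 except the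
non-surjective corner (T4″)₃, with NO condition on Tamagawa numbers or Kodaira types; the old domain
ClassX11b W 3 ∩ (KN₃)/ℚ is contained in the new one ((KN₃)/ℚ ⟹ surj(3) on the class).  §0 turns the
two named facts into the two x11b3 END binders at `3` on the class (`¬ CM` from `mult(3)`;
`d_K ∉ {−3, −4}` from `3 ∣ N_E` and the Heegner hypothesis; `3` odd; `ρ̄_{E,3}` onto = `hS`;
`N = N_E` = `hN`); §1 re-issues the four K-side ENDs from their hGZ-hypothesis parents
(`…_of_leafInputs_of_poitouTate`, x11b3 GEN 35) with `hPT`, `hrec`, `hCM`, `h53` discharged by the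
tree theorems exactly as in GEN 52, `hGZ` / `hγ` by §0; conclusions VERBATIM the GEN 53 ones.
CONDITIONAL on EXACTLY the two named facts {`GrossLMS1991.prop37_2_reductionCongruence N W K 3`,
`Gross1991_heegnerPoint_sub_ratTorsion_mem_E0`} (PUBLISHED, citation-tagged `def … : Prop`s of
`Literature/`, NOT discharged here, both XL) + `hN` + `hS`; a conditional result (D-0014 named
facts), not an unconditional theorem; nothing booked.  The ℚ-side / class-level forms are
`X11b/Three/KolyvaginShaThreeRatOfGross1991`.

## What is proved (namespace `Summit.BirchSwinnertonDyer.Rank1Residual.X11b.Three.KolyvaginDischarged`)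

* §0 `hGZ_endBinder_three_of_classX11b_of_surj`, `prop37_endBinder_three_of_classX11b_of_surj` —
  the x11b3 END binders `hGZ`, `hγ` at `3` on ClassX11b W 3 ∩ surj(3) from the two NAMED facts.
* `sha_primary_finite_three_of_classX11b_of_surj_of_gross1991E0_of_prop37` — `Ш(E/K)[3^∞]` finite.
* `pow_smul_sha_three_primary_eq_zero_of_classX11b_of_surj_of_gross1991E0_of_prop37` —
  `3^{m+1} ∤ y_K ⟹ 3^{m} · Ш(E/K)[3^∞] = 0`.
* `pow_smul_sha_three_primary_eq_zero_of_classX11b_of_surj_of_gross1991E0_index_of_prop37` —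
  `3^{ord_3 [E(K) : ℤ y_K]} · Ш(E/K)[3^∞] = 0`.
* `sha_three_primary_eq_zero_of_classX11b_of_surj_of_gross1991E0_of_not_dvd_of_prop37` —
  `3 ∤ y_K ⟹ Ш(E/K)[3^∞] = 0` (Gross 1991 Prop. 2.1 (2) at `p = 3`).
Each for `(E, 3) ∈ ClassX11b W 3` with `Surj W 3`, at `N = N_E`, any `K : Type` imaginary quadratic
with the Heegner hypothesis and a non-torsion Heegner point `P`; modulo EXACTLY the two named facts.

## References

* [GrossLMS1991] B. H. Gross, *Kolyvagin's work on modular elliptic curves*, LMS LNS 153 (1991),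
  §1 (p. 235), §2 (p. 237) Prop. 2.1, Thm. 1.3 (2), §3 Prop. 3.7 (2) (p. 240), Prop. 5.3,
  §6 Prop. 6.2 (1) and its proof (p. 245).
* [McCallumLMS1991] W. G. McCallum, *Kolyvagin's work on Shafarevich–Tate groups*, same volume,
  §1 Theorem (Kolyvagin), Lemma 5.1 (p. 303), §5.
* [GrossZagier1986Heegner] B. H. Gross, D. B. Zagier, Invent. Math. 84 (1986), III (3.1) (p. 256).
* [SilvermanATAEC1994] Thm. II.6.4.  [SilvermanAEC2009] VII.1 Prop. 1.3 (b), VII.2 Prop. 2.1.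
  [Mazur1977] III §5.  [Darmon2004] Thm. 3.6, 3.7.

presearch: `lean search 'of_surj_of_gross1991E0'` → none before this GEN; `rg
Gross1991_heegnerPoint_sub_ratTorsion_mem_E0 Summits/…/X11b` → 0 consumers before this GEN (the
x11b3 `p = 3` ENDs all on (KN₃)); parents and dischargers = the tree theorems named above;
[corpus: book:editornd-l-functions-arithmetic p0222:L1, p0217:L19–L22, p0214:L5–L9]; nothing minted.
-/

noncomputable section

open scoped Classical
open WeierstrassCurve Field NumberField IsDedekindDomain
open Literature.NumberTheory.EllipticCurves Literature.NumberTheory.GaloisRepresentations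
open Literature.NumberTheory.EllipticCurves.Rank1Residual
open Literature.NumberTheory.EllipticCurves.RingClassField
open Literature.NumberTheory.EllipticCurves.ModularForms
open Literature.NumberTheory.DiophantineGeometry Literature.NumberTheory.DiophantineGeometry.TateAlgorithm
open Literature.NumberTheory.EllipticCurves.GrossLMS1991 (prop37_2_reductionCongruence)
open Literature.NumberTheory.GaloisCohomology (poitouTate_sum_localTatePairing_eq_zero_holds)

namespace Summit.BirchSwinnertonDyer.Rank1Residual.X11b.Three.KolyvaginDischarged

-- `K : Type`: the tree's ring-class class field theory is universe `0`.
variable {K : Type} [Field K] [NumberField K] {N : ℕ} {W : WeierstrassCurve ℚ}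

/-! ### §0 The two x11b3 END binders at `3` on ClassX11b W 3 ∩ surj(3) from the two NAMED facts -/

/-- **On ClassX11b W 3 ∩ surj(3) at `N = N_E`, the NAMED fact Gross 1991 §6 / [GZ86, III (3.1)]
(`Gross1991_heegnerPoint_sub_ratTorsion_mem_E0`) yields the x11b3 receptacle binder `hGZ` at `3` —
NO Kodaira–Néron hypothesis** (compare `KolyvaginHloc.hGZ_of_kodairaNeron_three[_rat]`, which needs
(KN₃)).  Its standing hypotheses are discharged on the class: `¬ CM` from `mult(3)`
(`not_hasMultiplicativeReductionAtPrime_of_hasCM`, Silverman ATAEC II.6.4); `d_K ∉ {−3, −4}` from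
`3 ∣ N_E` and the Heegner hypothesis (`Three.KolyvaginHexc.discr_ne_of_satisfiesHeegnerHypothesis_of_three_dvd`);
`3` an odd prime; `ρ̄_{E,3}` onto = `hS`; `N = N_E` = `hN`; then `KolyvaginHloc.hGZ_of_gross1991E0`.
The conclusion is the `p := 3` instance of the binder `hGZ` of
`Three.sha_primary_finite_three_of_leafInputs_of_poitouTate`, character for character.  Plumbing;
conditional on the named fact (NOT discharged); nothing booked; no mark.
[cite: GrossLMS1991, §6, proof of Prop. 6.2 (1), p. 245; §1 p. 235; §2 p. 237]
[cite: GrossZagier1986Heegner, III (3.1) Proposition, p. 256] [cite: SilvermanATAEC1994, Thm. II.6.4] -/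
theorem hGZ_endBinder_three_of_classX11b_of_surj (hE0 : Gross1991_heegnerPoint_sub_ratTorsion_mem_E0)
    [NeZero N] [W.IsGloballyMinimal] (hW : ClassX11b W 3) (hS : Surj W 3)
    (hN : ∀ [W.IsElliptic], N = W.conductorNorm ℤ) :
    ∀ [W.IsElliptic] (_hK : IsImaginaryQuadratic K) (_hH : SatisfiesHeegnerHypothesis N K)
      (Dt : ModularParametrizationData W N) (β : ℤ) (ι : K →+* ℂ) {M : ℕ} (_hM : 1 ≤ M) {n : ℕ}
      (_hn : Squarefree n)
      (_hKol : ∀ q ∈ n.primeFactors, IsKolyvaginPrime N W K 3 q ∧ FrobEqFrobInfty W K (3 ^ M) q)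
      (d : (m : ℕ) → m ∣ n → KolyvaginHeegnerData Dt β ι m),
      ∃ n' : ℤ, IsCoprime ((3 ^ M : ℕ) : ℤ) n' ∧
        ∀ (m : ℕ) (hm : m ∣ n) (γ : ringClassField K ι m ≃ₐ[ℚ] ringClassField K ι m),
          γ ∈ ringClassGal ι m → ∀ v : HeightOneSpectrum (𝓞 K),
            ¬ (W.baseChange K).HasGoodReductionAt v →
            n' • pointsMap (W.baseChange K) (v.adicCompletion K)
                ((d m hm).toGeomPoints (pointGalHom W (ringClassField K ι m) γ (d m hm).y)) ∈
              E0Receptacle (W.baseChange K) v ∧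
            ∀ (ℓ : ℕ) (hℓ : ℓ ∈ m.primeFactors)
              (hle : ringClassField K ι (m / ℓ) ≤ ringClassField K ι m),
              n' • pointsMap (W.baseChange K) (v.adicCompletion K)
                  ((d m hm).toGeomPoints (pointGalHom W (ringClassField K ι m) γ
                    (WeierstrassCurve.Affine.Point.map (W' := W)
                      ((RingClassField.inclusion ι hle).restrictScalars ℚ)
                      (d (m / ℓ)
                        ((Nat.div_dvd_of_dvd (Nat.dvd_of_mem_primeFactors hℓ)).trans hm)).y))) ∈
                E0Receptacle (W.baseChange K) v := by
  intro _ hK hH Dt β ι M _ n hn hKol d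
  have hmult : W.HasMultiplicativeReductionAtPrime 3 := hW.2.2.1
  have hE : ¬ W.HasCM := fun hCM ↦ W.not_hasMultiplicativeReductionAtPrime_of_hasCM hCM 3 hmult
  have h3 : 3 ∣ N := by
    rw [hN]
    exact (W.dvd_conductorNorm_iff_not_hasGoodReductionAtPrime 3).mpr
      (not_hasGoodReductionAtPrime_of_hasMultiplicativeReductionAtPrime 3 hmult)
  exact KolyvaginHloc.hGZ_of_gross1991E0 hE0 hN hE hK
    (Three.KolyvaginHexc.discr_ne_of_satisfiesHeegnerHypothesis_of_three_dvd hK.1 hH h3) hH ι Dt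
    Nat.prime_three (by decide) hS hn hKol d

/-- **On ClassX11b W 3 ∩ surj(3) at `N = N_E`, the NAMED fact Gross 1991 Prop. 3.7 (2) at `p = 3`
(`GrossLMS1991.prop37_2_reductionCongruence N W K 3`) yields the x11b3 END binder `hγ` — NO
Kodaira–Néron hypothesis** (compare GEN 53's `prop37_endBinder_three_of_classX11b`, which takes
`ρ̄_{E,3}` onto from (KN₃)/ℚ): its six standing hypotheses are discharged on the class as in
`hGZ_endBinder_three_of_classX11b_of_surj`, with `ρ̄_{E,3}` onto = `hS`; then `hγ.endBinder`.  The
conclusion is the `p := 3` instance of the binder `hγ`, character for character.  Plumbing;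
conditional on the named fact (NOT discharged); nothing booked; no mark.
[cite: GrossLMS1991, §3 Prop. 3.7 (2) (p. 240), §1 (p. 235), §2 (p. 237)]
[cite: SilvermanATAEC1994, Thm. II.6.4] -/
theorem prop37_endBinder_three_of_classX11b_of_surj [NeZero N] [W.IsGloballyMinimal]
    (hW : ClassX11b W 3) (hS : Surj W 3) (hN : ∀ [W.IsElliptic], N = W.conductorNorm ℤ)
    (hγ : prop37_2_reductionCongruence N W K 3) :
    ∀ [W.IsElliptic] (_hK : IsImaginaryQuadratic K) (_hH : SatisfiesHeegnerHypothesis N K)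
      (Dt : ModularParametrizationData W N) (β : ℤ) (ι : K →+* ℂ) {M : ℕ}
      (_hM : 1 ≤ M) {n : ℕ} (_hn : Squarefree n)
      (_hKol : ∀ q ∈ n.primeFactors, IsKolyvaginPrime N W K 3 q ∧ FrobEqFrobInfty W K (3 ^ M) q)
      (d : (m : ℕ) → m ∣ n → KolyvaginHeegnerData Dt β ι m)
      (m : ℕ) (hm : m ∣ n) (ℓ : ℕ) (hℓ : ℓ ∈ m.primeFactors) [Fact ℓ.Prime]
      (hΔ : ¬ (ℓ : ℤ) ∣ minimalDiscriminantInt W) (φ₀ : absoluteGaloisGroup (ZMod ℓ)),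
      (∀ x : AlgebraicClosure (ZMod ℓ), φ₀ • x = x ^ ℓ) →
      ∀ (hle : ringClassField K ι (m / ℓ) ≤ ringClassField K ι m)
        (γ : ringClassField K ι m ≃ₐ[ℚ] ringClassField K ι m), γ ∈ ringClassGal ι m →
        geomReduction hΔ ((RatClosure.pointsEquiv (K := K) W).symm
            ((d m hm).toGeomPoints (pointGalHom W (ringClassField K ι m) γ (d m hm).y))) =
          φ₀ • geomReduction hΔ ((RatClosure.pointsEquiv (K := K) W).symm
            ((d m hm).toGeomPoints (pointGalHom W (ringClassField K ι m) γ
              (WeierstrassCurve.Affine.Point.map (W' := W)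
                ((RingClassField.inclusion ι hle).restrictScalars ℚ)
                (d (m / ℓ)
                  ((Nat.div_dvd_of_dvd (Nat.dvd_of_mem_primeFactors hℓ)).trans hm)).y)))) := by
  intro _ hK hH Dt β ι M hM n hn hKol d m hm ℓ hℓ _ hΔ φ₀ hφ₀ hle γ hγm
  have hmult : W.HasMultiplicativeReductionAtPrime 3 := hW.2.2.1
  have hE : ¬ W.HasCM := fun hCM ↦ W.not_hasMultiplicativeReductionAtPrime_of_hasCM hCM 3 hmult
  have h3 : 3 ∣ N := by
    rw [hN]
    exact (W.dvd_conductorNorm_iff_not_hasGoodReductionAtPrime 3).mpr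
      (not_hasGoodReductionAtPrime_of_hasMultiplicativeReductionAtPrime 3 hmult)
  exact hγ hE (Three.KolyvaginHexc.discr_ne_of_satisfiesHeegnerHypothesis_of_three_dvd hK.1 hH h3)
    Nat.prime_three (by decide) hS hN hK hH Dt β ι hM hn hKol d m hm ℓ hℓ hΔ φ₀ hφ₀ hle γ hγm

/-! ### §1 The four K-side ENDs on ClassX11b W 3 ∩ surj(3), no (KN₃) -/

/-- **On the class X11b @ 3 with `ρ̄_{E,3}` onto, `Ш(E/K)[3^∞]` is finite — NO Kodaira–Néron
hypothesis — modulo the TWO NAMED facts `GrossLMS1991.prop37_2_reductionCongruence N W K 3` and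
`Gross1991_heegnerPoint_sub_ratTorsion_mem_E0`, no inline cite-only input.**  The hGZ-hypothesis
parent `Three.sha_primary_finite_three_of_leafInputs_of_poitouTate` (x11b3 GEN 35) with `hPT`,
`hrec`, `hCM`, `h53` SUPPLIED by the tree theorems (`poitouTate_sum_localTatePairing_eq_zero_holds`,
`heegnerPointOfConductor_one_galoisConj_holds`, `KolyvaginLeaves.hCM_holds`, `KolyvaginLeaves.h53_holds`)
and `hGZ`, `hγ` by §0.  For `(E, 3) ∈ ClassX11b W 3` (`r_an = 1`, `3 ‖ N`, `ρ̄_{E,3}` irreducible)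
with `Surj W 3`, at `N = N_E` (`hN`), any `K : Type` imaginary quadratic with the Heegner hypothesis
and a non-torsion Heegner point `P`: `{c ∈ Ш(E/K) | 3^j c = 0}` is finite.  The conclusion is GEN
53's `sha_primary_finite_three_of_classX11b_of_kodairaNeron_rat_of_prop37` VERBATIM, the binders
`hKN3m` / `hKN3a` REPLACED by `hS` + `hE0`.  CONDITIONAL on EXACTLY the two named facts (PUBLISHED,
NOT discharged) + `hN` + `hS`; nothing booked; no mark / count / tier moves.
[cite: McCallumLMS1991, §1 Theorem (Kolyvagin)] [cite: GrossLMS1991, Thm. 1.3 (2), §3 Prop. 3.7 (2) (p. 240), §6 Prop. 6.2 (1) (p. 245)]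
[cite: GrossZagier1986Heegner, III (3.1) Proposition, p. 256] -/
theorem sha_primary_finite_three_of_classX11b_of_surj_of_gross1991E0_of_prop37 [NeZero N]
    [W.IsGloballyMinimal] (hW : ClassX11b W 3) (hS : Surj W 3)
    (hN : ∀ [W.IsElliptic], N = W.conductorNorm ℤ)
    (hE0 : Gross1991_heegnerPoint_sub_ratTorsion_mem_E0) (hγ : prop37_2_reductionCongruence N W K 3) :
    ∀ [W.IsElliptic] (_hK : IsImaginaryQuadratic K) (_hH : SatisfiesHeegnerHypothesis N K)
      {P : (W.baseChange K).toAffine.Point} (_hP : IsHeegnerPoint N W K P)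
      (_hnt : ¬ IsOfFinAddOrder P),
      Set.Finite {c : (W.baseChange K).sha | ∃ j : ℕ, 3 ^ j • c = 0} := by
  intro _ hK hH P hP hnt
  exact Three.sha_primary_finite_three_of_leafInputs_of_poitouTate
    (poitouTate_sum_localTatePairing_eq_zero_holds K) hN hW.2.2.1
    (heegnerPointOfConductor_one_galoisConj_holds N W K) (KolyvaginLeaves.hCM_holds N W K 3)
    (@fun _ ↦ KolyvaginLeaves.h53_holds hN 3)
    (@fun _ ↦ hGZ_endBinder_three_of_classX11b_of_surj hE0 hW hS hN)
    (@fun _ ↦ prop37_endBinder_three_of_classX11b_of_surj hW hS hN hγ) hK hH hP hnt hS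

/-- **On the class X11b @ 3 with `ρ̄_{E,3}` onto: `3^{m} · Ш(E/K)[3^∞] = 0` for every `m` with
`3^{m+1} ∤ y_K` — NO Kodaira–Néron hypothesis — modulo the TWO NAMED facts** (Kolyvagin's
annihilator; McCallum §1 Theorem / §5 with Lemma 5.1).  The hGZ-hypothesis parent
`Three.KolyvaginAnnihilator.pow_smul_sha_three_primary_eq_zero_of_leafInputs_of_poitouTate` with
`hPT`, `hrec`, `hCM`, `h53` SUPPLIED by the tree theorems and `hGZ`, `hγ` by §0; conclusion VERBATIM
GEN 53's `…_of_kodairaNeron_rat_of_prop37`, binders `hKN3m` / `hKN3a` REPLACED by `hS` + `hE0`.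
CONDITIONAL on EXACTLY the two named facts + `hN` + `hS`; nothing booked; no mark.
[cite: McCallumLMS1991, §1 Theorem (Kolyvagin), Lemma 5.1] [cite: GrossLMS1991, Thm. 1.3 (2), §3 Prop. 3.7 (2), §6 Prop. 6.2 (1), §10]
[cite: GrossZagier1986Heegner, III (3.1) Proposition, p. 256] -/
theorem pow_smul_sha_three_primary_eq_zero_of_classX11b_of_surj_of_gross1991E0_of_prop37 [NeZero N]
    [W.IsGloballyMinimal] (hW : ClassX11b W 3) (hS : Surj W 3)
    (hN : ∀ [W.IsElliptic], N = W.conductorNorm ℤ)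
    (hE0 : Gross1991_heegnerPoint_sub_ratTorsion_mem_E0) (hγ : prop37_2_reductionCongruence N W K 3) :
    ∀ [W.IsElliptic] (_hK : IsImaginaryQuadratic K) (_hH : SatisfiesHeegnerHypothesis N K)
      {P : (W.baseChange K).toAffine.Point} (_hP : IsHeegnerPoint N W K P)
      (_hnt : ¬ IsOfFinAddOrder P) {m : ℕ}
      (_hm : ∀ Q : (W.baseChange K).toAffine.Point, 3 ^ (m + 1) • Q ≠ P) (c : (W.baseChange K).sha),
      (∃ j : ℕ, 3 ^ j • c = 0) → 3 ^ m • c = 0 := by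
  intro _ hK hH P hP hnt m hm
  exact Three.KolyvaginAnnihilator.pow_smul_sha_three_primary_eq_zero_of_leafInputs_of_poitouTate
    (poitouTate_sum_localTatePairing_eq_zero_holds K) hN hW.2.2.1
    (heegnerPointOfConductor_one_galoisConj_holds N W K) (KolyvaginLeaves.hCM_holds N W K 3)
    (@fun _ ↦ KolyvaginLeaves.h53_holds hN 3)
    (@fun _ ↦ hGZ_endBinder_three_of_classX11b_of_surj hE0 hW hS hN)
    (@fun _ ↦ prop37_endBinder_three_of_classX11b_of_surj hW hS hN hγ) hK hH hP hnt hS hm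

/-- **On the class X11b @ 3 with `ρ̄_{E,3}` onto: `3^{ord_3 [E(K) : ℤ y_K]} · Ш(E/K)[3^∞] = 0` —
NO Kodaira–Néron hypothesis — modulo the TWO NAMED facts** — the Heegner-INDEX form (McCallum
1991, §1 Theorem in EXPONENT form with Lemma 5.1: *"`M₀ = ord_p [E(K) : ℤ y_K]`"*), for
`[E(K) : ℤ P]` finite (`_hidx`; the index is Mathlib's `AddSubgroup.index`, `0` when infinite):
`3^{m+1} P' = P` would force `3^{m+1} ∣ [E(K) : ℤ P]` (tree `X11b.index_zmultiples_zsmul`), so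
`m = ord_3 [E(K) : ℤ P]` satisfies `3^{m+1} ∤ P` and the annihilator END applies (the proof of GEN
35's `…_rat_index` re-run).  Conclusion VERBATIM GEN 53's `…_rat_index_of_prop37`.  CONDITIONAL on
EXACTLY the two named facts + `hN` + `hS`; nothing booked; no mark.
[cite: McCallumLMS1991, §1 Theorem (Kolyvagin), Lemma 5.1 (p. 303)] [cite: GrossLMS1991, Thm. 1.3 (2), §3 Prop. 3.7 (2), §6 Prop. 6.2 (1)]
[cite: GrossZagier1986Heegner, III (3.1) Proposition, p. 256] -/
theorem pow_smul_sha_three_primary_eq_zero_of_classX11b_of_surj_of_gross1991E0_index_of_prop37 [NeZero N]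
    [W.IsGloballyMinimal] (hW : ClassX11b W 3) (hS : Surj W 3)
    (hN : ∀ [W.IsElliptic], N = W.conductorNorm ℤ)
    (hE0 : Gross1991_heegnerPoint_sub_ratTorsion_mem_E0) (hγ : prop37_2_reductionCongruence N W K 3) :
    ∀ [W.IsElliptic] (_hK : IsImaginaryQuadratic K) (_hH : SatisfiesHeegnerHypothesis N K)
      {P : (W.baseChange K).toAffine.Point} (_hP : IsHeegnerPoint N W K P)
      (_hnt : ¬ IsOfFinAddOrder P) (_hidx : (AddSubgroup.zmultiples P).index ≠ 0)
      (c : (W.baseChange K).sha), (∃ j : ℕ, 3 ^ j • c = 0) →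
      3 ^ padicValNat 3 (AddSubgroup.zmultiples P).index • c = 0 := by
  intro _ hK hH P hP hnt hidx c hc
  set m := padicValNat 3 (AddSubgroup.zmultiples P).index with hm_def
  refine pow_smul_sha_three_primary_eq_zero_of_classX11b_of_surj_of_gross1991E0_of_prop37 hW hS hN
    hE0 hγ hK hH hP hnt (m := m) (fun Q hQ ↦ ?_) c hc
  -- `3^{m+1} Q = P` forces `3^{m+1} ∣ [E(K) : ℤ P]` (McCallum Lemma 5.1), contradicting `m = ord_3`
  have hQ' : (((3 ^ (m + 1) : ℕ) : ℤ)) • Q = P := by rw [natCast_zsmul]; exact hQ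
  have hQinf : ¬ IsOfFinAddOrder Q := fun h ↦ hnt (by rw [← hQ']; exact h.zsmul)
  have hdvd : 3 ^ (m + 1) ∣ (AddSubgroup.zmultiples P).index := by
    refine ⟨(AddSubgroup.zmultiples Q).index, ?_⟩
    conv_lhs => rw [← hQ']
    rw [X11b.index_zmultiples_zsmul hQinf, Int.natAbs_natCast]
  have hle := (padicValNat_dvd_iff_le hidx).mp hdvd
  omega

/-- **On the class X11b @ 3 with `ρ̄_{E,3}` onto: `3 ∤ y_K` in `E(K)` ⟹ `Ш(E/K)[3^∞] = 0` — NO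
Kodaira–Néron hypothesis — modulo the TWO NAMED facts** (Gross 1991 Prop. 2.1 (2) at `p = 3`: the
`m = 0` case of the annihilator).  Conclusion VERBATIM GEN 53's `…_of_not_dvd_of_prop37`.
CONDITIONAL on EXACTLY the two named facts + `hN` + `hS`; nothing booked; no mark.
[cite: GrossLMS1991, §2 Prop. 2.1 (2), §3 Prop. 3.7 (2), §6 Prop. 6.2 (1)] [cite: McCallumLMS1991, §1 Theorem (Kolyvagin)]
[cite: GrossZagier1986Heegner, III (3.1) Proposition, p. 256] -/
theorem sha_three_primary_eq_zero_of_classX11b_of_surj_of_gross1991E0_of_not_dvd_of_prop37 [NeZero N]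
    [W.IsGloballyMinimal] (hW : ClassX11b W 3) (hS : Surj W 3)
    (hN : ∀ [W.IsElliptic], N = W.conductorNorm ℤ)
    (hE0 : Gross1991_heegnerPoint_sub_ratTorsion_mem_E0) (hγ : prop37_2_reductionCongruence N W K 3) :
    ∀ [W.IsElliptic] (_hK : IsImaginaryQuadratic K) (_hH : SatisfiesHeegnerHypothesis N K)
      {P : (W.baseChange K).toAffine.Point} (_hP : IsHeegnerPoint N W K P)
      (_hnt : ¬ IsOfFinAddOrder P)
      (_h3 : ∀ Q : (W.baseChange K).toAffine.Point, 3 • Q ≠ P) (c : (W.baseChange K).sha),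
      (∃ j : ℕ, 3 ^ j • c = 0) → c = 0 := by
  intro _ hK hH P hP hnt h3 c hc
  have h := pow_smul_sha_three_primary_eq_zero_of_classX11b_of_surj_of_gross1991E0_of_prop37 hW hS hN
    hE0 hγ hK hH hP hnt (m := 0) (fun Q ↦ by simpa using h3 Q) c hc
  simpa using h

end Summit.BirchSwinnertonDyer.Rank1Residual.X11b.Three.KolyvaginDischarged

end
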